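import Summits.BirchSwinnertonDyer.BirchSwinnertonDyer.Theorems.KolyvaginRankRigidityAtTwoOffHabitatIrredKolyvaginRelationAtTwo
import Summits.BirchSwinnertonDyer.BirchSwinnertonDyer.Theorems.KolyvaginRankRigidityAtTwoOffHabitatIrredNonSurjTwoConverseNoTwoTorsionOverKOfIrred
import Literature.NumberTheory.EllipticCurves.TwoAdicImageSurjectivityModTwoProofs
import HarnessLib

/-!
# Route `CMKolyvaginAtInertTwo`, crux `CMKolyvaginExactAtInertTwo` (stmt-BirchSwinnertonDyer-24277):
# McCallum's Prop. 4.4 «in particular» AT `2` (gk2's Q2 `KolyvaginRelationAtTwo`) IN THE SHAPE THE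
# CM-INERT HABITAT SUPPLIES — `ρ̄_{E,2}` onto, `d_K` odd — modulo Gross 1991 Prop. 3.7 (2), like Q2 itself

Seat `bsd-line-cmk2-p1` g16 (cell `bsd-print-cf2`); helper (`--supports stmt-BirchSwinnertonDyer-24277`).
THEOREMS ONLY: no definition, no named fact, no `sorry`; CONDITIONAL on the print fact
`GrossLMS1991.prop37_2_frobeniusCongruence` (gk2 item 23091; Nekovář 2007 Prop. 4.9) exactly as Q2 is
(`GenusExact.kolyvaginRelationAtTwo_of_frobeniusCongruence`, p614530); no item is closed; BSD is not
proved by this.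

WHY. The Kolyvagin relation at `2` (`2^j c_M(mℓ)` Selmer at `λ ∣ ℓ` iff it vanishes at `λ` iff
`2^j c_M(m)` vanishes at `λ`) is the `c_mem_loc_iff` field of every `SplitDataM` at `2` and the antecedent
of the `GenusKolyvaginAtTwo` lower-half engines (`…RTRungSupplyKolyvagin`, `…RTBottomRungLocalInputs`),
which consume the route decl `KolyvaginRelationAtTwo` BY NAME — a `∀`-statement binding `¬ W.HasCM` and
the surjective `2`-adic tower, both FALSE on `H₂`. The krr2 seat proved the pair theorem off the habitat
from `E(ℚ)[2] = 0` alone (`GenusExact.kolyvaginRelationAtTwo_pair_of_congruence_offHabitat`, no CM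
binder). This file is the `∀`-statement a CM-inert port consumes: Q2's text with `¬ W.HasCM` and
`∀ n, ρ̄_{E,2^n} onto` replaced by **`ρ̄_{E,2}` onto** and `d_K ≠ −4` by **`Odd d_K`** (the binders of
24277; `E(ℚ)[2] = 0` from surjectivity mod `2`, `d_K ≠ −4` from oddness):

* `kolyvaginRelationAtTwo_of_hasSurjectiveModNGaloisRep_two_of_prop37_2` (from the tree's
  `prop37_2_reductionCongruence_inert` at `N = N_E`),
* `kolyvaginRelationAtTwo_of_hasSurjectiveModNGaloisRep_two_of_frobeniusCongruence` (from Nekovář's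
  closed `Prop`).

References: [McCallumLMS1991] §4 Prop. 4.4 «In particular», (4)–(6), Lemma 4.3; [GrossLMS1991]
Prop. 3.6, 3.7 (2), Lemma 4.3; [Nekovar2007] Prop. 4.9.
-/

set_option autoImplicit false
-- the Theorems namespace of this sub repeats the summit name by design (D-0017 nested layout)
set_option linter.dupNamespace false

noncomputable section

open scoped Classical

namespace Summit.BirchSwinnertonDyer.BirchSwinnertonDyer.Theorems.KolyvaginDescentTwo

open WeierstrassCurve Field NumberField IsDedekindDomain Finset
open Literature.NumberTheory.EllipticCurves Literature.NumberTheory.GaloisRepresentations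
open Literature.NumberTheory.EllipticCurves.GrossLMS1991
open Summit.BirchSwinnertonDyer.BirchSwinnertonDyer.Theorems.GenusExact

/-- `ρ̄_{E,2}` onto ⟹ `E(ℚ)[2] = 0` (no rational root of the `2`-division cubic). [folklore] -/
private theorem torsionBy_two_eq_bot_of_surj (W : WeierstrassCurve ℚ) [W.IsElliptic]
    (hρ : W.HasSurjectiveModNGaloisRep 2) : AddSubgroup.torsionBy W.toAffine.Point (2 : ℤ) = ⊥ :=
  KolyvaginRankRigidity.torsionBy_two_eq_bot_iff_forall_two_nsmul.mpr
    ((hasSurjectiveModNGaloisRep_two_iff W).mp hρ).1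

/-- An odd discriminant is not `−4`. [folklore] -/
private theorem discr_ne_neg_four_of_odd {K : Type} [Field K] [NumberField K]
    (hodd : Odd (NumberField.discr K)) : NumberField.discr K ≠ -4 := by
  intro h; rw [h] at hodd; exact absurd hodd (by decide)

/-- **Q2 `KolyvaginRelationAtTwo` in the CM-inert habitat's shape, from Gross 1991 Prop. 3.7 (2)**
(the tree's `p`-free, image-free `prop37_2_reductionCongruence_inert` at `N = N_W`): Q2's text with the
binders `¬ W.HasCM`, `∀ n, ρ̄_{E,2^n} onto`, `d_K ≠ −4` replaced by `ρ̄_{E,2}` onto and `Odd d_K`. Proof: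
krr2's `kolyvaginRelationAtTwo_pair_of_congruence_offHabitat` with `E(ℚ)[2] = 0` from surjectivity.
CONDITIONAL on the displayed print fact. [cite: McCallumLMS1991, §4 Prop. 4.4 «In particular» (p. 301)]
[cite: GrossLMS1991, Prop. 3.7 (2) (p. 240)] [cite: Nekovar2007, Prop. 4.9] -/
theorem kolyvaginRelationAtTwo_of_hasSurjectiveModNGaloisRep_two_of_prop37_2
    (h37 : ∀ (W : WeierstrassCurve ℚ) [W.IsGloballyMinimal] [NeZero (W.conductorNorm ℤ)]
      (K : Type) [Field K] [NumberField K],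
      prop37_2_reductionCongruence_inert (W.conductorNorm ℤ) W K) :
    ∀ (W : WeierstrassCurve ℚ) [W.IsElliptic] [W.IsGloballyMinimal] [NeZero (W.conductorNorm ℤ)],
      W.HasSurjectiveModNGaloisRep 2 → ∀ (K : Type) [Field K] [NumberField K],
      Literature.NumberTheory.EllipticCurves.IsImaginaryQuadratic K → Odd (NumberField.discr K) →
      NumberField.discr K ≠ -3 →
      Literature.NumberTheory.EllipticCurves.SatisfiesHeegnerHypothesis (W.conductorNorm ℤ) K → ∀ (Dt :
      Literature.NumberTheory.EllipticCurves.ModularForms.ModularParametrizationData W (W.conductorNorm ℤ))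
      (β : ℤ) (ι : K →+* ℂ) (M : ℕ), 1 ≤ M → ∀ (m l : ℕ), Squarefree (m * l) → l.Prime → ¬ l ∣ m → (∀ l' ∈
      (m * l).primeFactors, Literature.NumberTheory.EllipticCurves.Zhang2014.IsKolyvaginPrime
      (W.conductorNorm ℤ) W K 2 l' ∧ M ≤ Literature.NumberTheory.EllipticCurves.Zhang2014.kolyvaginIndex W 2
      l') → ∀ (d : Literature.NumberTheory.EllipticCurves.KolyvaginHeegnerData Dt β ι m) (d' :
      Literature.NumberTheory.EllipticCurves.KolyvaginHeegnerData Dt β ι (m * l)), (∀ l' ∈ m.primeFactors, ∀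
      (x : Literature.NumberTheory.EllipticCurves.ringClassField K ι m) (x' :
      Literature.NumberTheory.EllipticCurves.ringClassField K ι (m * l)), (x : ℂ) = x' → ((d'.σ l' x' :
      Literature.NumberTheory.EllipticCurves.ringClassField K ι (m * l)) : ℂ) = (d.σ l' x : ℂ)) → (∀ s ∈
      d.S, ∃ s' ∈ d'.S, ∀ (x : Literature.NumberTheory.EllipticCurves.ringClassField K ι m) (x' :
      Literature.NumberTheory.EllipticCurves.ringClassField K ι (m * l)), (x : ℂ) = x' → ((s' x' :
      Literature.NumberTheory.EllipticCurves.ringClassField K ι (m * l)) : ℂ) = (s x : ℂ)) → (∀ s' ∈ d'.S, ∃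
      s ∈ d.S, ∀ (x : Literature.NumberTheory.EllipticCurves.ringClassField K ι m) (x' :
      Literature.NumberTheory.EllipticCurves.ringClassField K ι (m * l)), (x : ℂ) = x' → ((s' x' :
      Literature.NumberTheory.EllipticCurves.ringClassField K ι (m * l)) : ℂ) = (s x : ℂ)) → (∀ (x :
      Literature.NumberTheory.EllipticCurves.ringClassField K ι m) (x' :
      Literature.NumberTheory.EllipticCurves.ringClassField K ι (m * l)), (x : ℂ) = x' → d'.emb x' = d.emb
      x) → ∀ (v : IsDedekindDomain.HeightOneSpectrum (NumberField.RingOfIntegers K)), (l :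
      NumberField.RingOfIntegers K) ∈ v.asIdeal → ∀ (j : ℕ), ((((2 ^ j : ℕ) : ℤ) • d'.kolyvaginClass
      Nat.prime_two M ∈ WeierstrassCurve.selmerLocalKer (W.baseChange K) (v.adicCompletion K) ((2 ^ M : ℕ) :
      ℤ) ↔ ((2 ^ j : ℕ) : ℤ) • d'.kolyvaginClass Nat.prime_two M ∈ (W.baseChange K).torsionLocalKer
      (v.adicCompletion K) ((2 ^ M : ℕ) : ℤ)) ∧ (((2 ^ j : ℕ) : ℤ) • d'.kolyvaginClass Nat.prime_two M ∈
      (W.baseChange K).torsionLocalKer (v.adicCompletion K) ((2 ^ M : ℕ) : ℤ) ↔ ((2 ^ j : ℕ) : ℤ) •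
      d.kolyvaginClass Nat.prime_two M ∈ (W.baseChange K).torsionLocalKer (v.adicCompletion K) ((2 ^ M : ℕ)
      : ℤ))) := by
  intro W _ _ _ hρ K _ _ hK hodd hD3 hH Dt β ι M _ m l hsq hl hlm hS d d' hσ hS₁ hS₂ hemb v hv j
  have hD4 : NumberField.discr K ≠ -4 := discr_ne_neg_four_of_odd hodd
  have htorQ := torsionBy_two_eq_bot_of_surj W hρ
  have hn0 : m * l ≠ 0 := hsq.ne_zero
  have hl' : l ∈ (m * l).primeFactors := Nat.mem_primeFactors.mpr ⟨hl, dvd_mul_left l m, hn0⟩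
  have hodd' : ∀ q ∈ (m * l).primeFactors, q ≠ 2 := fun q hq ↦
    zhangKolyvaginPrime_ne_two Nat.prime_two (by norm_num) (hS q hq).1
  have hinert : ∀ q ∈ (m * l).primeFactors, ¬ q ∣ W.conductorNorm ℤ ∧
      ¬ ((q : ℤ) ∣ NumberField.discr K) ∧ (Ideal.span {(q : 𝓞 K)}).IsPrime :=
    fun q hq ↦ ⟨(hS q hq).1.2.1, (hS q hq).1.2.2.1, (hS q hq).1.2.2.2.2.1⟩
  exact kolyvaginRelationAtTwo_pair_of_congruence_offHabitat hK hD3 hD4 hH htorQ Dt β ι M m l hsq hl hlm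
    hS d d' hσ hS₁ hS₂ hemb (congruence_pair_of_prop37_2_inert (h37 W K) rfl hK ⟨hD3, hD4⟩ hH Dt β ι hsq
      hodd' hinert hl' (Nat.mul_div_cancel m hl.pos) d' d) v hv j

/-- **The same from Nekovář's image-free congruence** `prop37_2_frobeniusCongruence` (one closed `Prop`;
gk2 item 23091), via `prop37_2_reductionCongruence_inert_of_frobeniusCongruence`. CONDITIONAL on that
print fact. [cite: Nekovar2007, Prop. 4.9] [cite: GrossLMS1991, Prop. 3.7 (2)] [cite: McCallumLMS1991, §4 Prop. 4.4] -/
theorem kolyvaginRelationAtTwo_of_hasSurjectiveModNGaloisRep_two_of_frobeniusCongruence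
    (h : prop37_2_frobeniusCongruence) :
    ∀ (W : WeierstrassCurve ℚ) [W.IsElliptic] [W.IsGloballyMinimal] [NeZero (W.conductorNorm ℤ)],
      W.HasSurjectiveModNGaloisRep 2 → ∀ (K : Type) [Field K] [NumberField K],
      Literature.NumberTheory.EllipticCurves.IsImaginaryQuadratic K → Odd (NumberField.discr K) →
      NumberField.discr K ≠ -3 →
      Literature.NumberTheory.EllipticCurves.SatisfiesHeegnerHypothesis (W.conductorNorm ℤ) K → ∀ (Dt :
      Literature.NumberTheory.EllipticCurves.ModularForms.ModularParametrizationData W (W.conductorNorm ℤ))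
      (β : ℤ) (ι : K →+* ℂ) (M : ℕ), 1 ≤ M → ∀ (m l : ℕ), Squarefree (m * l) → l.Prime → ¬ l ∣ m → (∀ l' ∈
      (m * l).primeFactors, Literature.NumberTheory.EllipticCurves.Zhang2014.IsKolyvaginPrime
      (W.conductorNorm ℤ) W K 2 l' ∧ M ≤ Literature.NumberTheory.EllipticCurves.Zhang2014.kolyvaginIndex W 2
      l') → ∀ (d : Literature.NumberTheory.EllipticCurves.KolyvaginHeegnerData Dt β ι m) (d' :
      Literature.NumberTheory.EllipticCurves.KolyvaginHeegnerData Dt β ι (m * l)), (∀ l' ∈ m.primeFactors, ∀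
      (x : Literature.NumberTheory.EllipticCurves.ringClassField K ι m) (x' :
      Literature.NumberTheory.EllipticCurves.ringClassField K ι (m * l)), (x : ℂ) = x' → ((d'.σ l' x' :
      Literature.NumberTheory.EllipticCurves.ringClassField K ι (m * l)) : ℂ) = (d.σ l' x : ℂ)) → (∀ s ∈
      d.S, ∃ s' ∈ d'.S, ∀ (x : Literature.NumberTheory.EllipticCurves.ringClassField K ι m) (x' :
      Literature.NumberTheory.EllipticCurves.ringClassField K ι (m * l)), (x : ℂ) = x' → ((s' x' :
      Literature.NumberTheory.EllipticCurves.ringClassField K ι (m * l)) : ℂ) = (s x : ℂ)) → (∀ s' ∈ d'.S, ∃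
      s ∈ d.S, ∀ (x : Literature.NumberTheory.EllipticCurves.ringClassField K ι m) (x' :
      Literature.NumberTheory.EllipticCurves.ringClassField K ι (m * l)), (x : ℂ) = x' → ((s' x' :
      Literature.NumberTheory.EllipticCurves.ringClassField K ι (m * l)) : ℂ) = (s x : ℂ)) → (∀ (x :
      Literature.NumberTheory.EllipticCurves.ringClassField K ι m) (x' :
      Literature.NumberTheory.EllipticCurves.ringClassField K ι (m * l)), (x : ℂ) = x' → d'.emb x' = d.emb
      x) → ∀ (v : IsDedekindDomain.HeightOneSpectrum (NumberField.RingOfIntegers K)), (l :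
      NumberField.RingOfIntegers K) ∈ v.asIdeal → ∀ (j : ℕ), ((((2 ^ j : ℕ) : ℤ) • d'.kolyvaginClass
      Nat.prime_two M ∈ WeierstrassCurve.selmerLocalKer (W.baseChange K) (v.adicCompletion K) ((2 ^ M : ℕ) :
      ℤ) ↔ ((2 ^ j : ℕ) : ℤ) • d'.kolyvaginClass Nat.prime_two M ∈ (W.baseChange K).torsionLocalKer
      (v.adicCompletion K) ((2 ^ M : ℕ) : ℤ)) ∧ (((2 ^ j : ℕ) : ℤ) • d'.kolyvaginClass Nat.prime_two M ∈
      (W.baseChange K).torsionLocalKer (v.adicCompletion K) ((2 ^ M : ℕ) : ℤ) ↔ ((2 ^ j : ℕ) : ℤ) •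
      d.kolyvaginClass Nat.prime_two M ∈ (W.baseChange K).torsionLocalKer (v.adicCompletion K) ((2 ^ M : ℕ)
      : ℤ))) :=
  kolyvaginRelationAtTwo_of_hasSurjectiveModNGaloisRep_two_of_prop37_2 fun W _ _ K _ _ ↦
    prop37_2_reductionCongruence_inert_of_frobeniusCongruence h (W.conductorNorm ℤ) W K

end Summit.BirchSwinnertonDyer.BirchSwinnertonDyer.Theorems.KolyvaginDescentTwo

end
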